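import Literature.NumberTheory.Rogawski1990.ArchExplicitTransferFactor
import Literature.NumberTheory.Automorphic.TorusCharacterLocalComponents
import Literature.NumberTheory.GaloisRepresentations.AlgebraicHeckeCharacterGrossencharakterProofs
import Literature.NumberTheory.GaloisRepresentations.HeckeCharacterDictionary
import Literature.NumberTheory.Automorphic.QuaternionRamificationParityHolds
import HarnessLib

/-!
# The three global reciprocity laws behind «`Π_v Δ_v(γ, γ) = 1`» for Rogawski's EXPLICIT transfer factor, in the place currency of
# ★ `ArchExplicitTransferFactor` (`∞`) and `FinExplicitTransferFactor` (finite places of `L⁺`, semi-local rings `∏_{w ∣ v} L_w`)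

Topic `NumberTheory/Rogawski1990`; namespace `Literature.NumberTheory.Rogawski1990`.  THEOREMS ONLY (no definition, no named fact, no
instance, no notation, no `sorry`; net debt 0).  Cell `pub/hodgecm-mathlib`, F0∕P3a, topic T6 (#72 `GlobalTransferWithCartanKappaFormula` pay-down,
`F0/P3a/T6b-TREE.md` §9 (F3)–(F4)): the N1f-INDEPENDENT global halves of nodes **N3** (almost-everywhere triviality) and **N4** (product formula)
for the explicit collection `Δ‴ = (Δ‴_v)_v`, `Δ‴_v = τ_v · D_{G∕H,v} · κ_v` [Rogawski1990 §4.9 p. 55], whose product formula print states as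
«By a global property of transfer factors (cf. §4.9), `Π_v Δ′_v(γ, i(γ)) = 1`», «`Π_v Δ_v(γ, γ) = 1`» [§14.6 p. 242].  On a RATIONAL matching pair
every local ingredient is the image of a GLOBAL element (`u = γ₂ ∈ L^×`, `χ_g(u) ∈ L^×`, `x = pᴴH′p ∈ L⁺^×`), and the three factors of
`Π_{v ≤ ∞} Δ‴_v` are killed by three classical reciprocity laws, here stated in EXACTLY the currency the explicit factors are typed in —
a subfield `F ⊆ E` of number fields (`F = L⁺`, `E = L`), the finite places `v` of `F`, the places `w ∣ v` of `E` (★ `UnitaryGroup.PlacesOver E v`),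
the semi-local ring `E ⊗_F F_v = ∏_{w ∣ v} E_w` (★ `UnitaryGroup.LocalRing E v`), and at `∞` Mathlib's `mixedEmbedding E : E →+* E ⊗ ℝ` read through
★ `UnitaryGroup.evalC` (the embedding ★ `UnitaryGroup.rationalToArch` of rational points is entrywise `mixedEmbedding`):

* §1 `finprod_eq_finprod_prod_placesOver` — bookkeeping: a finitely supported product over the finite places of `E` regrouped along `F`,
  `∏ᶠ_w f w = ∏ᶠ_v ∏_{w ∣ v} f w`.
* §2 THE `D_{G∕H}`-FACTOR (absolute values; Artin–Whaples): `prod_infinitePlace_mul_finprod_prod_placesOver_norm_eq_one` (Mathlib's product formula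
  `NumberField.prod_abs_eq_one` regrouped along `F`) and, for `E` totally complex (CM), the SQUARE-ROOT form
  **`prod_norm_evalC_mul_finprod_sqrt_prod_placesOver_norm_eq_one`**: `(∏_{w complex} ‖(k ⊗ 1)_w‖) · ∏ᶠ_v √(∏_{w ∣ v} ‖k‖_w) = 1` — the currency of
  ★ `archWeylRatio` (`∏_w ‖χ_g(γ₂)_w‖`) and `finWeylRatio` (`√∏_{w∣v} ‖χ_g(γ₂)_w‖_w`); a.e. rider `eventually_prod_placesOver_norm_coe_eq_one`.
* §3 THE `τ`-FACTOR (Hecke character `μ` of `E`): **`map_infiniteIdeles_mul_finprod_semilocalComponent_eq_one`** — `μ((k)_∞) · ∏ᶠ_v μ_v((k)_v) = 1`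
  with `μ_v` = ★ `HeckeCharacter.semilocalComponent μ v` at the semi-local unit `(k)_v = (k, …, k) ∈ (∏_{w∣v} E_w)ˣ` (★ Neukirch decomposition
  `map_principalIdele_eq` under a module of definition ★ `exists_isModulus`, + §1), its `ℂ`-valued form
  **`archHeckeValue_mul_finprod_semilocalComponent_eq_one`** with ★ `archHeckeValue μ (mixedEmbedding E k)` at `∞` (the `μ_∞` of ★ `archTau`;
  `archHeckeValue_mixedEmbedding`), and the a.e. rider `eventually_semilocalComponent_map_algebraMap_eq_one` (`μ` unramified a.e., ★
  `finite_ramifiedPlaces_holds`; `k` a unit a.e.).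
* §4 THE `κ`-FACTOR (norm-residue symbols): **`finprod_hilbertSymbol_mul_prod_infinitePlace_hilbertSymbol_eq_one`** — Hilbert's reciprocity law ★
  `hilbertReciprocity_holds` (O'Meara 71:18, PROVED in the tree) in product form `(∏ᶠ_v (a, b)_v) · ∏_{w∣∞} (a, b)_w = 1` for `a, b ∈ Fˣ`, with the
  a.e. rider `eventually_hilbertSymbol_adicCompletion_eq_one`; for `b = d`, `L = L⁺(√d)`, `(x, d)_v` is the norm-residue symbol of `L ⊗ L⁺_v ∕ L⁺_v`
  read by `finKappaAt` (O'Meara 63:10) and `(x, d)_w = sgn_w(x)` at the real places (`d` totally negative).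

NOT here (provers' nodes on the T6b-TREE, after N1f is ★): the RATIONAL-PAIR LOCALISATION (the `fin*` ∕ `arch*` readings of a rational pair are
the images of the global `u`, `χ_g(u)`, `det g`, `P`, `pᴴH′p`), the bridge `finKappaAt = hilbertSymbol (·, d)` at non-split `v`, and the assembly of
`SatisfiesProductFormula (finExplicitCollection …) (archCanonicalDelta …)` (N4) ∕ `IsAlmostEverywhereTrivial (finExplicitCollection …)` (N3).
HONEST LABEL: HC_CM is proved only modulo the printed citations (named inputs remaining 2) until rung 0 closes; this file is classical
number theory (product formula, Hecke characters on principal idèles, Hilbert reciprocity) and proves none of them.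

## References
* [Rogawski1990] J. D. Rogawski, *Automorphic Representations of Unitary Groups in Three Variables*, Ann. of Math. Stud. 123 (1990), §4.9 p. 55
  (`τ`, `D_{G∕H}`, `Δ_{G∕H}`), §4.3 (4.3.3) p. 44, §14.6 p. 242 («`Π_v Δ_v(γ, γ) = 1`»).
* [CasselsFrohlichANT1967] J. W. S. Cassels, A. Fröhlich (eds.), *Algebraic Number Theory* (1967), Ch. II §11 (`L ⊗_K K_v = ∏_{w∣v} L_w`),
  §12 (product formula).
* [TateThesis1967] J. Tate, *Fourier analysis in number fields and Hecke's zeta-functions*, ibid. Ch. XV, §3.2 (Lemma 3.2.1), §4.3.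
* [NeukirchANT1999] J. Neukirch, *Algebraic Number Theory* (1999), Ch. VII §6 Prop. (6.13) (proof: `a = a_f a_∞`).
* [Omeara1963] O. T. O'Meara, *Introduction to Quadratic Forms* (1963), §63 (63:10), §71 Thm. 71:18 (Hilbert reciprocity).
-/
set_option autoImplicit false

noncomputable section

open NumberField NumberField.InfinitePlace NumberField.mixedEmbedding IsDedekindDomain Filter
open Literature.NumberTheory.GaloisRepresentations
open scoped Classical

namespace Literature.NumberTheory.Rogawski1990

open Literature.NumberTheory.Automorphic

section Regroup

variable (F : Type) {E : Type} [Field F] [NumberField F] [Field E] [NumberField E] [Algebra F E]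

/-- **Regrouping a finitely supported product over the finite places of `E` along the places of a subfield `F`**:
`∏ᶠ_w f(w) = ∏ᶠ_v ∏_{w ∣ v} f(w)`. [cite: CasselsFrohlichANT1967, Ch. II §11] -/
theorem finprod_eq_finprod_prod_placesOver {M : Type*} [CommMonoid M] (f : HeightOneSpectrum (𝓞 E) → M)
    (hf : (Function.mulSupport f).Finite) :
    ∏ᶠ w, f w = ∏ᶠ v : HeightOneSpectrum (𝓞 F), ∏ w : UnitaryGroup.PlacesOver E v, f w.1 := by
  set S : Finset (HeightOneSpectrum (𝓞 E)) := hf.toFinset with hS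
  have hg : Function.mulSupport (fun v : HeightOneSpectrum (𝓞 F) => ∏ w : UnitaryGroup.PlacesOver E v, f w.1) ⊆
      (S.image fun w => w.under (𝓞 F) : Finset (HeightOneSpectrum (𝓞 F))) := by
    intro v hv
    by_contra hv'
    refine hv (Finset.prod_eq_one fun w _ => ?_)
    by_contra hw
    exact hv' (Finset.mem_coe.2 (Finset.mem_image.2 ⟨w.1, hf.mem_toFinset.2 hw, w.2⟩))
  rw [finprod_eq_prod_of_mulSupport_subset f (s := S) (by simp [hS]), finprod_eq_prod_of_mulSupport_subset _ hg,
    ← Finset.prod_fiberwise_of_maps_to (g := fun w : HeightOneSpectrum (𝓞 E) => w.under (𝓞 F))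
      (fun w hw => Finset.mem_image_of_mem _ hw) f]
  refine Finset.prod_congr rfl fun v _ => ?_
  -- `∏_{w ∈ S, w ∣ v} f w = ∏_{w ∣ v} f w`: the factors off `S` are `1`
  rw [← Finset.prod_subtype_map_embedding (fun w _ => rfl)]
  refine Finset.prod_subset (fun w hw => ?_) (fun w hw hwS => ?_)
  · exact Finset.mem_map.2 ⟨⟨w, (Finset.mem_filter.1 hw).2⟩, Finset.mem_univ _, rfl⟩
  · obtain ⟨w', -, rfl⟩ := Finset.mem_map.1 hw
    by_contra hne
    exact hwS (Finset.mem_filter.2 ⟨hf.mem_toFinset.2 hne, w'.2⟩)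

end Regroup

section AbsoluteValues

variable (F : Type) {E : Type} [Field F] [NumberField F] [Field E] [NumberField E] [Algebra F E]

omit [NumberField F] [Algebra F E] in
/-- The normalised absolute values `‖k‖_w` of a non-zero `k ∈ E` are `1` at almost all finite places `w` (Mathlib's
`FinitePlace.hasFiniteMulSupport`, re-indexed by `HeightOneSpectrum`). [cite: CasselsFrohlichANT1967, Ch. II §12] -/
theorem finite_mulSupport_norm_coe_adicCompletion {k : E} (hk : k ≠ 0) :
    (Function.mulSupport fun w : HeightOneSpectrum (𝓞 E) => ‖(k : w.adicCompletion E)‖).Finite := by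
  have h := FinitePlace.hasFiniteMulSupport hk
  have he : (fun w : HeightOneSpectrum (𝓞 E) => ‖(k : w.adicCompletion E)‖) =
      (fun w : FinitePlace E => w k) ∘ (FinitePlace.equivHeightOneSpectrum (K := E)).symm := by
    funext w
    rw [Function.comp_apply, FinitePlace.equivHeightOneSpectrum_symm_apply]
    rfl
  rw [he, Function.mulSupport_comp_eq_preimage]
  exact h.preimage (FinitePlace.equivHeightOneSpectrum.symm.injective.injOn)

omit [NumberField F] [Algebra F E] in
/-- A.e. rider in the semi-local currency: `∏_{w ∣ v} ‖k‖_w = 1` for almost all finite places `v` of the subfield `F`.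
[cite: CasselsFrohlichANT1967, Ch. II §12] -/
theorem eventually_prod_placesOver_norm_coe_eq_one [NumberField F] [Algebra F E] {k : E} (hk : k ≠ 0) :
    ∀ᶠ v : HeightOneSpectrum (𝓞 F) in cofinite, ∏ w : UnitaryGroup.PlacesOver E v, ‖(k : w.1.adicCompletion E)‖ = 1 := by
  have h := (finite_mulSupport_norm_coe_adicCompletion hk).image fun w : HeightOneSpectrum (𝓞 E) => w.under (𝓞 F)
  refine (eventually_cofinite.2 (h.subset fun v hv => ?_))
  by_contra hv'
  refine hv (Finset.prod_eq_one fun w _ => ?_)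
  by_contra hw
  exact hv' ⟨w.1, hw, w.2⟩

/-- **THE PRODUCT FORMULA, regrouped along `F ⊆ E`**: for `k ∈ Eˣ`,
`(∏_{w ∣ ∞} |k|_w^{[E_w : ℝ]}) · ∏_v ∏_{w ∣ v} ‖k‖_w = 1` (Mathlib `NumberField.prod_abs_eq_one`, the finite places grouped by the
place of `F` below them). [cite: CasselsFrohlichANT1967, Ch. II §12 (product formula)] -/
theorem prod_infinitePlace_mul_finprod_prod_placesOver_norm_eq_one {k : E} (hk : k ≠ 0) :
    (∏ w : InfinitePlace E, w k ^ w.mult) *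
        ∏ᶠ v : HeightOneSpectrum (𝓞 F), ∏ w : UnitaryGroup.PlacesOver E v, ‖(k : w.1.adicCompletion E)‖ = 1 := by
  rw [← finprod_eq_finprod_prod_placesOver F (fun w : HeightOneSpectrum (𝓞 E) => ‖(k : w.adicCompletion E)‖)
    (finite_mulSupport_norm_coe_adicCompletion hk)]
  have h := NumberField.prod_abs_eq_one hk
  rw [← finprod_comp_equiv FinitePlace.equivHeightOneSpectrum.symm] at h
  convert h using 2
  refine finprod_congr fun w => ?_
  rw [FinitePlace.equivHeightOneSpectrum_symm_apply]
  rfl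

omit [NumberField F] [Algebra F E] [NumberField E] in
/-- At a complex place `w`, `‖(k ⊗ 1)_w‖ = |k|_w` for the `w`-coordinate ★ `UnitaryGroup.evalC` of Mathlib's `mixedEmbedding`.
[cite: CasselsFrohlichANT1967, Ch. II §12] -/
theorem norm_evalC_mixedEmbedding (w : {w : InfinitePlace E // IsComplex w}) (k : E) :
    ‖UnitaryGroup.evalC E w (mixedEmbedding E k)‖ = w.1 k := by
  rw [UnitaryGroup.evalC_apply, mixedEmbedding_apply_isComplex, norm_embedding_eq]

/-- **THE PRODUCT FORMULA IN THE `D_{G∕H}` CURRENCY of ★ `archWeylRatio` ∕ `finWeylRatio`** (a totally complex `E`, e.g. a CM field; every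
infinite place complex, `[E_w : ℝ] = 2`, so the square root is taken place by place): for `k ∈ Eˣ`,
`(∏_{w complex} ‖(k ⊗ 1)_w‖) · ∏_v √(∏_{w ∣ v} ‖k‖_w) = 1` — print's «`Π_v D_{G∕H,v}(γ) = 1`» ingredient of «`Π_v Δ_v(γ, γ) = 1`» for a
rational `γ` (`D_{G∕H,v}(γ) = |N χ_g(u)|_v^{1∕2}` with `χ_g(u) ∈ L^×`). [cite: Rogawski1990, §14.6 p. 242] [cite: CasselsFrohlichANT1967, Ch. II §12] -/
theorem prod_norm_evalC_mul_finprod_sqrt_prod_placesOver_norm_eq_one [IsTotallyComplex E] {k : E} (hk : k ≠ 0) :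
    (∏ w : {w : InfinitePlace E // IsComplex w}, ‖UnitaryGroup.evalC E w (mixedEmbedding E k)‖) *
        ∏ᶠ v : HeightOneSpectrum (𝓞 F), Real.sqrt (∏ w : UnitaryGroup.PlacesOver E v, ‖(k : w.1.adicCompletion E)‖) = 1 := by
  set P : ℝ := ∏ w : {w : InfinitePlace E // IsComplex w}, ‖UnitaryGroup.evalC E w (mixedEmbedding E k)‖ with hP
  set b : HeightOneSpectrum (𝓞 F) → ℝ := fun v => ∏ w : UnitaryGroup.PlacesOver E v, ‖(k : w.1.adicCompletion E)‖ with hb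
  have hb0 : ∀ v, 0 ≤ b v := fun v => Finset.prod_nonneg fun _ _ => norm_nonneg _
  have hbfin : (Function.mulSupport b).Finite := by
    refine ((finite_mulSupport_norm_coe_adicCompletion hk).image fun w : HeightOneSpectrum (𝓞 E) => w.under (𝓞 F)).subset
      fun v hv => ?_
    by_contra hv'
    refine hv (Finset.prod_eq_one fun w _ => ?_)
    by_contra hw
    exact hv' ⟨w.1, hw, w.2⟩
  have hsfin : (Function.mulSupport fun v => Real.sqrt (b v)).Finite :=
    hbfin.subset fun v hv => by
      intro hv1
      refine hv ?_
      change Real.sqrt (b v) = 1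
      rw [hv1, Real.sqrt_one]
  -- `P² = ∏_{w ∣ ∞} |k|_w^{mult w}`
  have hP2 : P ^ 2 = ∏ w : InfinitePlace E, w k ^ w.mult := by
    rw [hP, ← Finset.prod_pow]
    refine Fintype.prod_equiv (Equiv.subtypeUnivEquiv fun w : InfinitePlace E => IsTotallyComplex.isComplex w) _ _
      fun w => ?_
    rw [norm_evalC_mixedEmbedding, Equiv.subtypeUnivEquiv_apply, mult_isComplex]
  -- `(∏ᶠ √b)² = ∏ᶠ b`
  have hQ2 : (∏ᶠ v, Real.sqrt (b v)) ^ 2 = ∏ᶠ v, b v := by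
    rw [finprod_pow hsfin]
    exact finprod_congr fun v => Real.sq_sqrt (hb0 v)
  have hprod : (P * ∏ᶠ v, Real.sqrt (b v)) ^ 2 = 1 := by
    rw [mul_pow, hP2, hQ2, hb]
    exact prod_infinitePlace_mul_finprod_prod_placesOver_norm_eq_one F hk
  have hnn : 0 ≤ P * ∏ᶠ v, Real.sqrt (b v) :=
    mul_nonneg (Finset.prod_nonneg fun _ _ => norm_nonneg _) (finprod_nonneg fun v => Real.sqrt_nonneg _)
  have h := (pow_eq_one_iff_of_nonneg hnn two_ne_zero).1 hprod
  rw [hb] at h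
  exact h

end AbsoluteValues

section Hecke

variable (F : Type) {E : Type} [Field F] [NumberField F] [Field E] [NumberField E] [Algebra F E]

omit [NumberField F] in
/-- The `w`-coordinate of the semi-local unit `(k)_v ∈ (∏_{w ∣ v} E_w)ˣ` of a global `k ∈ Eˣ` is `k ∈ E_wˣ` (★ `globalToLocalUnits`).
[cite: TateThesis1967, §4.3] -/
theorem piUnits_map_algebraMap (v : HeightOneSpectrum (𝓞 F)) (k : Eˣ) (w : UnitaryGroup.PlacesOver E v) :
    MulEquiv.piUnits (Units.map (algebraMap E (UnitaryGroup.LocalRing E v) : E →* UnitaryGroup.LocalRing E v) k) w =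
      globalToLocalUnits w.1 k :=
  Units.ext rfl

/-- **`μ_v((k)_v) = ∏_{w ∣ v} μ(⟨k⟩_w)`**: the semi-local component ★ `HeckeCharacter.semilocalComponent` of a Hecke character of `E` at a
finite place `v` of `F`, read at a global unit, is the product of its values on the single-place idèles ★ `localUnits w (k)`.
[cite: TateThesis1967, §4.3] -/
theorem semilocalComponent_map_algebraMap (μ : HeckeCharacter E) (v : HeightOneSpectrum (𝓞 F)) (k : Eˣ) :
    μ.semilocalComponent E v (Units.map (algebraMap E (UnitaryGroup.LocalRing E v) : E →* UnitaryGroup.LocalRing E v) k) =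
      ∏ w : UnitaryGroup.PlacesOver E v, μ (localUnits w.1 (globalToLocalUnits w.1 k)) := by
  rw [UnitaryGroup.semilocalComponent_eq_prod]
  exact Finset.prod_congr rfl fun w _ => by rw [piUnits_map_algebraMap, HeckeCharacter.localComponent_apply]

omit [NumberField F] [Algebra F E] in
/-- The finite places `w` of `E` at which a global `k ∈ Eˣ` is not a local unit form a finite set. [cite: CasselsFrohlichANT1967, Ch. II §12] -/
theorem finite_setOf_valuation_ne_one (k : Eˣ) : {w : HeightOneSpectrum (𝓞 E) | w.valuation E (k : E) ≠ 1}.Finite := by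
  refine (eventually_cofinite.1
    (ideleGroup_valued_snd_eventually_eq_one (GaloisRepresentations.principalIdele E k))).subset fun w hw => ?_
  intro hw1
  rw [principalIdele_snd] at hw1
  exact hw ((valued_algebraMap_adicCompletion w (k : E)).symm.trans hw1)

omit [NumberField F] [Algebra F E] in
/-- **`μ(⟨k⟩_w) = 1` for almost all `w`** (`k ∈ Eˣ` global): off the ramified places of `μ` (finitely many, ★ `finite_ramifiedPlaces_holds`)
and the places where `k` is not a unit. [cite: TateThesis1967, §4.3 with Lemma 3.2.1] -/
theorem finite_mulSupport_map_localUnits_globalToLocalUnits (μ : HeckeCharacter E) (k : Eˣ) :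
    (Function.mulSupport fun w : HeightOneSpectrum (𝓞 E) => μ (localUnits w (globalToLocalUnits w k))).Finite := by
  have h1 : μ.ramifiedPlaces.Finite := HeckeCharacter.finite_ramifiedPlaces_holds μ
  refine (h1.union (finite_setOf_valuation_ne_one k)).subset fun w hw => ?_
  by_contra hw'
  rw [Set.mem_union, not_or] at hw'
  refine hw (HeckeCharacter.IsUnramifiedAt.map_localUnits_eq_one (not_not.1 hw'.1) _ ?_)
  rw [val_globalToLocalUnits]
  exact (valued_algebraMap_adicCompletion w (k : E)).trans (not_not.1 hw'.2)

/-- **`μ_v((k)_v) = 1` for almost all finite places `v` of `F`** — the a.e. rider of the reciprocity law below (node N3's `τ`-factor).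
[cite: Rogawski1990, §14.6 p. 242] [cite: TateThesis1967, §4.3] -/
theorem eventually_semilocalComponent_map_algebraMap_eq_one (μ : HeckeCharacter E) (k : Eˣ) :
    ∀ᶠ v : HeightOneSpectrum (𝓞 F) in cofinite,
      μ.semilocalComponent E v (Units.map (algebraMap E (UnitaryGroup.LocalRing E v) : E →* UnitaryGroup.LocalRing E v) k) = 1 := by
  have h := (finite_mulSupport_map_localUnits_globalToLocalUnits μ k).image fun w : HeightOneSpectrum (𝓞 E) => w.under (𝓞 F)
  refine eventually_cofinite.2 (h.subset fun v hv => ?_)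
  by_contra hv'
  refine hv ?_
  rw [semilocalComponent_map_algebraMap]
  refine Finset.prod_eq_one fun w _ => ?_
  by_contra hw
  exact hv' ⟨w.1, hw, w.2⟩

/-- **THE RECIPROCITY LAW OF A HECKE CHARACTER, regrouped along `F ⊆ E`**: for `μ` a Hecke character of `E` and `k ∈ Eˣ`,
`μ((k)_∞) · ∏_v μ_v((k)_v) = 1`, the product over the finite places `v` of `F` of the semi-local components (a finite product by
`eventually_semilocalComponent_map_algebraMap_eq_one`) — `μ` is trivial on the principal idèle `k = (k)_∞ · ∏_w ⟨k⟩_w` (★ Neukirch's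
decomposition `map_principalIdele_eq` under a module of definition ★ `exists_isModulus`).  Print: the `τ = μ(γ₂)μ⁻¹(…)`-factor of
«`Π_v Δ_v(γ, γ) = 1`» for a rational `γ`. [cite: Rogawski1990, §14.6 p. 242] [cite: NeukirchANT1999, Ch. VII §6 Prop. (6.13) (proof)] -/
theorem map_infiniteIdeles_mul_finprod_semilocalComponent_eq_one (μ : HeckeCharacter E) (k : Eˣ) :
    μ (infiniteIdeles E (globalToInfiniteUnits E k)) *
        ∏ᶠ v : HeightOneSpectrum (𝓞 F),
          μ.semilocalComponent E v (Units.map (algebraMap E (UnitaryGroup.LocalRing E v) : E →* UnitaryGroup.LocalRing E v) k) = 1 := by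
  obtain ⟨T, e, hmod⟩ := HeckeCharacter.exists_isModulus μ
  have hfin := finite_mulSupport_map_localUnits_globalToLocalUnits μ k
  have hval := finite_setOf_valuation_ne_one k
  set S : Finset (HeightOneSpectrum (𝓞 E)) := T ∪ hfin.toFinset ∪ hval.toFinset with hSdef
  have hTS : T ⊆ S := (Finset.subset_union_left).trans Finset.subset_union_left
  have hS : ∀ w ∉ S, w.valuation E (k : E) = 1 := fun w hw => by
    by_contra hne
    exact hw (Finset.mem_union_right _ (hval.mem_toFinset.2 hne))
  have key := HeckeCharacter.map_principalIdele_eq hmod k hTS hS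
  rw [finprod_congr (semilocalComponent_map_algebraMap F μ · k),
    ← finprod_eq_finprod_prod_placesOver F _ hfin,
    finprod_eq_prod_of_mulSupport_subset _ (s := S) fun w hw =>
      Finset.mem_coe.2 (Finset.mem_union_left _ (Finset.mem_union_right _ (hfin.mem_toFinset.2 hw)))]
  exact key

omit [NumberField F] [Algebra F E] in
/-- **`μ_∞(k ⊗ 1) = μ((k)_∞)`**: ★ `archHeckeValue` (the `μ_∞` of ★ `archTau`) at the `mixedEmbedding` of a global unit is the value of `μ`
on the infinite part of the principal idèle (Mathlib `InfiniteAdeleRing.mixedEmbedding_eq_algebraMap_comp`). [cite: Rogawski1990, §4.9 p. 55] -/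
theorem archHeckeValue_mixedEmbedding (μ : HeckeCharacter E) (k : Eˣ) :
    archHeckeValue E μ (mixedEmbedding E (k : E)) = ((μ (infiniteIdeles E (globalToInfiniteUnits E k)) : ℂˣ) : ℂ) := by
  have hu : IsUnit (mixedEmbedding E (k : E)) := (k.isUnit).map _
  rw [archHeckeValue, dif_pos hu]
  congr 3
  refine Units.ext ?_
  change (InfiniteAdeleRing.ringEquiv_mixedSpace E).symm (mixedEmbedding E (k : E)) = algebraMap E (InfiniteAdeleRing E) k
  rw [InfiniteAdeleRing.mixedEmbedding_eq_algebraMap_comp]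
  exact (InfiniteAdeleRing.ringEquiv_mixedSpace E).symm_apply_apply _

/-- **THE RECIPROCITY LAW IN THE `τ`-CURRENCY of ★ `archTau` ∕ `finTau`**: for `k ∈ Eˣ`,
`μ_∞(k ⊗ 1) · ∏_v μ_v((k)_v) = 1` in `ℂ` (★ `archHeckeValue` at `∞`, ★ `semilocalComponent` at the finite places of `F`).
[cite: Rogawski1990, §14.6 p. 242] [cite: NeukirchANT1999, Ch. VII §6 Prop. (6.13) (proof)] -/
theorem archHeckeValue_mul_finprod_semilocalComponent_eq_one (μ : HeckeCharacter E) (k : Eˣ) :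
    archHeckeValue E μ (mixedEmbedding E (k : E)) *
        ∏ᶠ v : HeightOneSpectrum (𝓞 F),
          ((μ.semilocalComponent E v (Units.map (algebraMap E (UnitaryGroup.LocalRing E v) : E →* UnitaryGroup.LocalRing E v) k) :
              ℂˣ) : ℂ) = 1 := by
  have hf : (Function.mulSupport fun v : HeightOneSpectrum (𝓞 F) =>
      μ.semilocalComponent E v (Units.map (algebraMap E (UnitaryGroup.LocalRing E v) : E →* UnitaryGroup.LocalRing E v) k)).Finite :=
    eventually_cofinite.1 (eventually_semilocalComponent_map_algebraMap_eq_one F μ k)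
  have h := congrArg (Units.coeHom ℂ) (map_infiniteIdeles_mul_finprod_semilocalComponent_eq_one F μ k)
  rw [map_mul, map_one, MonoidHom.map_finprod _ hf] at h
  rw [archHeckeValue_mixedEmbedding]
  exact h

end Hecke

section NormResidue

open Literature.NumberTheory.QuadraticForms

variable (F : Type) [Field F] [NumberField F]

omit [NumberField F] in
/-- A finite product of signs is `(−1)^{#(−1)'s}`. [folklore] -/
private theorem prod_eq_neg_one_pow_card_filter {ι : Type*} (s : Finset ι) (f : ι → ℤ) (hf : ∀ i ∈ s, f i = 1 ∨ f i = -1) :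
    ∏ i ∈ s, f i = (-1) ^ (s.filter fun i => f i = -1).card := by
  rw [← Finset.prod_filter_of_ne (p := fun i => f i = -1) fun i hi hne => (hf i hi).resolve_left hne,
    Finset.prod_congr rfl fun i hi => (Finset.mem_filter.1 hi).2, Finset.prod_const]

/-- **`(a, b)_v = 1` for almost all finite places `v`** (`a, b ∈ Fˣ`): the finiteness half of Hilbert's reciprocity law (★
`hilbertReciprocity_holds`, O'Meara 71:18), the Hilbert symbol being `±1`-valued — the a.e. rider of the `κ_v`-factor (node N3).
[cite: Omeara1963, §71 Thm. 71:18] [cite: Rogawski1990, §14.6 p. 242] -/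
theorem eventually_hilbertSymbol_adicCompletion_eq_one {a b : F} (ha : a ≠ 0) (hb : b ≠ 0) :
    ∀ᶠ v : HeightOneSpectrum (𝓞 F) in cofinite,
      hilbertSymbol (v.adicCompletion F) (algebraMap F _ a) (algebraMap F _ b) = 1 :=
  eventually_cofinite.2 (((hilbertReciprocity_holds F a b) ha hb).1.subset fun _ hv =>
    (hilbertSymbol_eq_one_or_eq_neg_one _ _).resolve_left hv)

/-- **HILBERT'S RECIPROCITY LAW IN PRODUCT FORM over a number field `F`**: for `a, b ∈ Fˣ`,
`(∏_{v finite} (a, b)_v) · ∏_{w ∣ ∞} (a, b)_w = 1` — ★ `hilbertReciprocity_holds` (the set of places with symbol `−1` is finite of even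
cardinality) rewritten multiplicatively (the `∏ᶠ` is an honest finite product by `eventually_hilbertSymbol_adicCompletion_eq_one`).  With
`b = d`, `L = L⁺(√d)` CM (so `d < 0` at every real place and `(x, d)_w = sgn_w x`) this is the `κ`-factor «`Π_v κ_v = 1` on a rational pair»
of print's «`Π_v Δ_v(γ, γ) = 1`» (node N4; the local symbols are the norm-residue symbols of `L_w ∕ L⁺_v`, O'Meara 63:10).
[cite: Omeara1963, §71 Thm. 71:18] [cite: Rogawski1990, §14.6 p. 242] -/
theorem finprod_hilbertSymbol_mul_prod_infinitePlace_hilbertSymbol_eq_one {a b : F} (ha : a ≠ 0) (hb : b ≠ 0) :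
    (∏ᶠ v : HeightOneSpectrum (𝓞 F), hilbertSymbol (v.adicCompletion F) (algebraMap F _ a) (algebraMap F _ b)) *
        ∏ w : InfinitePlace F, hilbertSymbol w.Completion (algebraMap F _ a) (algebraMap F _ b) = 1 := by
  obtain ⟨hfin, heven⟩ := hilbertReciprocity_holds F a b ha hb
  set h : HeightOneSpectrum (𝓞 F) → ℤ := fun v => hilbertSymbol (v.adicCompletion F) (algebraMap F _ a) (algebraMap F _ b) with hh
  set h' : InfinitePlace F → ℤ := fun w => hilbertSymbol w.Completion (algebraMap F _ a) (algebraMap F _ b) with hh'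
  have hA : ∏ᶠ v, h v = (-1) ^ {v | h v = -1}.ncard := by
    rw [finprod_eq_prod_of_mulSupport_subset h (s := hfin.toFinset) fun v hv =>
        Finset.mem_coe.2 (hfin.mem_toFinset.2 ((hilbertSymbol_eq_one_or_eq_neg_one _ _).resolve_left hv)),
      prod_eq_neg_one_pow_card_filter _ h fun v _ => hilbertSymbol_eq_one_or_eq_neg_one _ _,
      Set.ncard_eq_toFinset_card _ hfin]
    congr 2
    exact Finset.filter_true_of_mem fun v hv => hfin.mem_toFinset.1 hv
  have hB : ∏ w, h' w = (-1) ^ {w | h' w = -1}.ncard := by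
    rw [prod_eq_neg_one_pow_card_filter _ h' fun w _ => hilbertSymbol_eq_one_or_eq_neg_one _ _, Set.ncard_eq_toFinset_card',
      Set.toFinset_setOf]
  change (∏ᶠ v, h v) * ∏ w, h' w = 1
  rw [hA, hB, ← pow_add]
  exact heven.neg_one_pow

end NormResidue

end Literature.NumberTheory.Rogawski1990
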